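import Summits.QuantumFields.QCD.Theorems.QuarksAsStableActionCriticalLineDiamagnetismCellKappaSoundA

/-!
# Cell-pressure certificate — soundness layer B: the planar-walk tables
(crux stmt-QuantumFields-9734, line `Sketch`, stub `stub_heavyFrequencyGain`, Route B step B6; lead c3)

The evaluator tabulates the planar walk sums `F_j` (`planarWalk`) on the box `[−K, K]²`, reading `0` outside.  Since a walk
of length `j` stays within `ℓ∞`-distance `j` (`planarWalk_eq_zero_far`), level `j` of the table is a sound enclosure at every
box point `(a, b)` with `max(|a|,|b|) + j ≤ 2K + 1` (`level0_sound`, `levelStep_sound`), and so is the running sum for the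
truncated propagator `g_J = Σ_{j ≤ J} F_j` (`propTable_sound`, registered).
-/

open Literature.Analysis.ValidatedNumerics
open Literature.MathematicalPhysics.QuantumLattice

namespace Summit.QuantumFields.QCD.Cruxes.CriticalLineDiamagnetism.ChessboardCellGain.CellKappa

variable {S : ℕ} {ε : ℕ → ℝ}

/-! ### Support of the planar walks -/

/-- One step moves the `ℓ∞`-front by at most one. -/
theorem far_step {j : ℕ} {z : ℤ × ℤ} (h : ((j + 1 : ℕ) : ℤ) < |z.1| ∨ ((j + 1 : ℕ) : ℤ) < |z.2|) {a b : ℤ}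
    (ha : |a| ≤ 1) (hb : |b| ≤ 1) : (j : ℤ) < |z.1 + a| ∨ (j : ℤ) < |z.2 + b| := by
  rw [abs_le] at ha hb
  push_cast at h
  rcases h with h | h
  · left; rw [lt_abs] at h ⊢; omega
  · right; rw [lt_abs] at h ⊢; omega

/-- Planar walks of length `j` from the origin do not reach beyond `ℓ∞`-distance `j`. -/
theorem planarWalk_eq_zero_far (M s₀ s₁ : ℝ) : ∀ (j : ℕ) (z : ℤ × ℤ),
    (j : ℤ) < |z.1| ∨ (j : ℤ) < |z.2| → planarWalk M s₀ s₁ j z = 0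
  | 0, z, h => by
    rw [planarWalk, if_neg]
    rintro rfl
    simp at h
  | j + 1, z, h => by
    rw [planarWalk]
    simp only [steps, List.map_cons, List.map_nil, List.sum_cons, List.sum_nil]
    rw [planarWalk_eq_zero_far M s₀ s₁ j _ (far_step h (a := 1) (b := 0) (by simp) (by simp)),
      planarWalk_eq_zero_far M s₀ s₁ j _ (far_step h (a := -1) (b := 0) (by simp) (by simp)),
      planarWalk_eq_zero_far M s₀ s₁ j _ (far_step h (a := 0) (b := 1) (by simp) (by simp)),
      planarWalk_eq_zero_far M s₀ s₁ j _ (far_step h (a := 0) (b := -1) (by simp) (by simp))]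
    simp

/-! ### Table indices -/

/-- In the box the table index splits as `(a+K)(2K+1) + (b+K)` with both digits `< 2K+1`. -/
theorem tabIdx_spec {K : ℕ} {a b : ℤ} (ha : |a| ≤ K) (hb : |b| ≤ K) :
    tabIdx K a b < (2 * K + 1) * (2 * K + 1) ∧ tabIdx K a b / (2 * K + 1) = (a + K).toNat ∧
      tabIdx K a b % (2 * K + 1) = (b + K).toNat := by
  rw [abs_le] at ha hb
  have h1 : (a + K).toNat + 1 ≤ 2 * K + 1 := by omega
  have h2 : (b + K).toNat < 2 * K + 1 := by omega
  unfold tabIdx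
  refine ⟨?_, ?_, ?_⟩
  · have h3 := Nat.mul_le_mul_right (2 * K + 1) h1
    rw [add_mul, one_mul] at h3
    exact lt_of_lt_of_le (Nat.add_lt_add_left h2 _) h3
  · rw [mul_comm, Nat.mul_add_div (by omega), Nat.div_eq_of_lt h2, add_zero]
  · rw [mul_comm, Nat.mul_add_mod, Nat.mod_eq_of_lt h2]

/-- First box coordinate recovered from the index. -/
theorem idx_fst {K : ℕ} {a b : ℤ} (ha : |a| ≤ K) (hb : |b| ≤ K) :
    ((tabIdx K a b / (2 * K + 1) : ℕ) : ℤ) - K = a := by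
  rw [(tabIdx_spec ha hb).2.1]; rw [abs_le] at ha; omega

/-- Second box coordinate recovered from the index. -/
theorem idx_snd {K : ℕ} {a b : ℤ} (ha : |a| ≤ K) (hb : |b| ≤ K) :
    ((tabIdx K a b % (2 * K + 1) : ℕ) : ℤ) - K = b := by
  rw [(tabIdx_spec ha hb).2.2]; rw [abs_le] at hb; omega

/-- Default access to an `Array.ofFn`. -/
theorem getD_ofFn {n : ℕ} (g : Fin n → CM) {i : ℕ} (hi : i < n) : (Array.ofFn g).getD i CM.zero = g ⟨i, hi⟩ := by
  rw [Array.getD_eq_getD_getElem?, Array.getElem?_ofFn, dif_pos hi, Option.getD_some]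

/-- Table lookup in the box of a table built by `Array.ofFn`. -/
theorem tabGet_ofFn {K : ℕ} (g : Fin ((2 * K + 1) * (2 * K + 1)) → CM) {a b : ℤ} (ha : |a| ≤ K) (hb : |b| ≤ K) :
    tabGet K (Array.ofFn g) a b = g ⟨tabIdx K a b, (tabIdx_spec ha hb).1⟩ := by
  unfold tabGet
  rw [if_pos ⟨ha, hb⟩, getD_ofFn g (tabIdx_spec ha hb).1]

/-- Table lookup in the box. -/
theorem tabGet_of_mem {K : ℕ} (T : Array CM) {a b : ℤ} (ha : |a| ≤ K) (hb : |b| ≤ K) :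
    tabGet K T a b = T.getD (tabIdx K a b) CM.zero := by
  unfold tabGet; rw [if_pos ⟨ha, hb⟩]

/-! ### Soundness of the levels -/

/-- Level `0` is sound on the whole box. -/
theorem level0_sound (hS : 0 < S) {M s₀ s₁ : ℝ} {nI : CM} (hn : CM.mem S ε (nInv M s₀ s₁) nI) (K : ℕ) {a b : ℤ}
    (ha : |a| ≤ K) (hb : |b| ≤ K) : CM.mem S ε (planarWalk M s₀ s₁ 0 (a, b)) (tabGet K (level0 K nI) a b) := by
  unfold level0
  rw [tabGet_ofFn _ ha hb]
  simp only [idx_fst ha hb, idx_snd ha hb]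
  rw [planarWalk]
  by_cases h : a = 0 ∧ b = 0
  · rw [if_pos h, if_pos (by rw [h.1, h.2])]; exact hn
  · rw [if_neg h, if_neg (by intro heq; simp only [Prod.ext_iff] at heq; exact h heq)]; exact CM.mem_zero hS

/-- Neighbour lookups of a level that is sound at the box points `(a, b)` with `max(|a|,|b|) + j ≤ 2K + 1`: inside the box
the table entry is sound, outside it reads `0 = F_j` by `planarWalk_eq_zero_far`. -/
theorem lookup_sound (hS : 0 < S) {M s₀ s₁ : ℝ} {K j : ℕ} {T : Array CM}
    (hT : ∀ a b : ℤ, |a| ≤ K → |b| ≤ K → |a| + j ≤ 2 * K + 1 → |b| + j ≤ 2 * K + 1 →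
      CM.mem S ε (planarWalk M s₀ s₁ j (a, b)) (tabGet K T a b))
    {a b a' b' : ℤ} (ha : |a| ≤ K) (hb : |b| ≤ K) (hja : |a| + (j + 1) ≤ 2 * K + 1) (hjb : |b| + (j + 1) ≤ 2 * K + 1)
    (ha' : |a'| ≤ |a| + 1) (hb' : |b'| ≤ |b| + 1) :
    CM.mem S ε (planarWalk M s₀ s₁ j (a', b')) (tabGet K T a' b') := by
  by_cases hin : |a'| ≤ K ∧ |b'| ≤ K
  · exact hT a' b' hin.1 hin.2 (by omega) (by omega)
  · have hfar : (j : ℤ) < |a'| ∨ (j : ℤ) < |b'| := by omega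
    rw [planarWalk_eq_zero_far M s₀ s₁ j (a', b') hfar]
    unfold tabGet
    rw [if_neg hin]
    exact CM.mem_zero hS

/-- The four first-order blocks sum to `½ ·` the Gaussian-integer combination used by the evaluator. -/
theorem steps_sum_eq (N W₁ W₂ W₃ W₄ : Matrix (Fin 4) (Fin 4) ℂ) :
    N * (pMinus 2 * W₁ + (pPlus 2 * W₂ + (pMinus 3 * W₃ + pPlus 3 * W₄))) =
      N * ((1 / 2 : ℂ) • (((1 - euclideanGamma 2) * W₁ + (1 + euclideanGamma 2) * W₂) +
        ((1 - euclideanGamma 3) * W₃ + (1 + euclideanGamma 3) * W₄))) := by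
  simp only [pMinus, pPlus, Matrix.smul_mul, ← smul_add, add_assoc]

/-- One recursion level: soundness propagates from level `j` to level `j + 1` (one `ℓ∞`-shell less). -/
theorem levelStep_sound (hS : 0 < S) (hε : AForm.Valid ε) {M s₀ s₁ : ℝ} {nI : CM} (hn : CM.mem S ε (nInv M s₀ s₁) nI)
    {K j : ℕ} {T : Array CM}
    (hT : ∀ a b : ℤ, |a| ≤ K → |b| ≤ K → |a| + j ≤ 2 * K + 1 → |b| + j ≤ 2 * K + 1 →
      CM.mem S ε (planarWalk M s₀ s₁ j (a, b)) (tabGet K T a b))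
    {a b : ℤ} (ha : |a| ≤ K) (hb : |b| ≤ K) (hja : |a| + (j + 1) ≤ 2 * K + 1) (hjb : |b| + (j + 1) ≤ 2 * K + 1) :
    CM.mem S ε (planarWalk M s₀ s₁ (j + 1) (a, b)) (tabGet K (levelStep S K nI T) a b) := by
  have hle : ∀ c : ℤ, |c| ≤ |c| + 1 := fun c => by linarith
  have m₁ := lookup_sound hS hT ha hb hja hjb (abs_add_le a 1 |>.trans (by simp)) (hle b)
  have m₂ := lookup_sound hS hT ha hb hja hjb (a' := a - 1) (abs_sub _ _ |>.trans (by simp)) (hle b)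
  have m₃ := lookup_sound hS hT ha hb hja hjb (hle a) (abs_add_le b 1 |>.trans (by simp))
  have m₄ := lookup_sound hS hT ha hb hja hjb (hle a) (b' := b - 1) (abs_sub _ _ |>.trans (by simp))
  have hacc := CM.mem_mul hS hε hn (CM.mem_half hε (CM.mem_add
    (CM.mem_add (CM.mem_gmulLeft (twoPMinusTab_spec 2) m₁) (CM.mem_gmulLeft (twoPPlusTab_spec 2) m₂))
    (CM.mem_add (CM.mem_gmulLeft (twoPMinusTab_spec 3) m₃) (CM.mem_gmulLeft (twoPPlusTab_spec 3) m₄))))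
  unfold levelStep
  rw [tabGet_ofFn _ ha hb]
  simp only [idx_fst ha hb, idx_snd ha hb]
  rw [planarWalk]
  simp only [steps, List.map_cons, List.map_nil, List.sum_cons, List.sum_nil, add_zero, ← sub_eq_add_neg]
  rw [steps_sum_eq]
  exact hacc

/-! ### The propagator table -/

/-- The truncated propagator grows by one level. -/
theorem propTrunc_succ (M s₀ s₁ : ℝ) (J : ℕ) (z : ℤ × ℤ) :
    propTrunc M s₀ s₁ (J + 1) z = propTrunc M s₀ s₁ J z + planarWalk M s₀ s₁ (J + 1) z := by
  simp only [propTrunc, List.range_succ, List.map_append, List.sum_append, List.map_cons, List.map_nil,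
    List.sum_cons, List.sum_nil, add_zero]

/-- `g_0 = F_0`. -/
theorem propTrunc_zero (M s₀ s₁ : ℝ) (z : ℤ × ℤ) : propTrunc M s₀ s₁ 0 z = planarWalk M s₀ s₁ 0 z := by
  simp [propTrunc]

/-- **Soundness of the propagator table** (registered helper): for `N⁻¹ ∈ nI`, level `J` of `propTable` encloses the
planar walk sum `F_J` and its running sum encloses the truncated propagator `g_J = Σ_{j ≤ J} F_j` at every box point
`(a, b)` with `max(|a|,|b|) + J ≤ 2K + 1`. -/
theorem propTable_sound : ∀ (S : ℕ), 0 < S → ∀ (ε : ℕ → ℝ), AForm.Valid ε → ∀ (M s₀ s₁ : ℝ) (nI : CM), CM.mem S ε (nInv M s₀ s₁) nI → ∀ (K J : ℕ) (a b : ℤ), |a| ≤ K → |b| ≤ K → |a| + J ≤ 2 * K + 1 → |b| + J ≤ 2 * K + 1 → CM.mem S ε (planarWalk M s₀ s₁ J (a, b)) (tabGet K (propTable S K nI J).1 a b) ∧ CM.mem S ε (propTrunc M s₀ s₁ J (a, b)) (tabGet K (propTable S K nI J).2 a b) := by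
  intro S hS ε hε M s₀ s₁ nI hn K J
  induction J with
  | zero =>
    intro a b ha hb _ _
    rw [propTrunc_zero]
    exact ⟨level0_sound hS hn K ha hb, level0_sound hS hn K ha hb⟩
  | succ J ih =>
    intro a b ha hb hja hjb
    have hT : ∀ a b : ℤ, |a| ≤ K → |b| ≤ K → |a| + J ≤ 2 * K + 1 → |b| + J ≤ 2 * K + 1 →
        CM.mem S ε (planarWalk M s₀ s₁ J (a, b)) (tabGet K (propTable S K nI J).1 a b) :=
      fun a b ha hb hja hjb => (ih a b ha hb hja hjb).1
    have h1 : CM.mem S ε (planarWalk M s₀ s₁ (J + 1) (a, b)) (tabGet K (propTable S K nI (J + 1)).1 a b) := by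
      simp only [propTable]
      exact levelStep_sound hS hε hn hT ha hb hja hjb
    refine ⟨h1, ?_⟩
    have h2 := (ih a b ha hb (by omega) (by omega)).2
    rw [propTrunc_succ]
    rw [tabGet_of_mem _ ha hb] at h1 h2
    simp only [propTable] at h1 ⊢
    rw [tabGet_ofFn _ ha hb]
    exact CM.mem_add h2 h1

end Summit.QuantumFields.QCD.Cruxes.CriticalLineDiamagnetism.ChessboardCellGain.CellKappa
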